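import Summits.BirchSwinnertonDyer.BirchSwinnertonDyer.Theses.ShaPrimaryTransfer
import Summits.BirchSwinnertonDyer.BirchSwinnertonDyer.Theorems.ShaPrimaryTransferFiniteShaComponentTransferGaussianTwistDoor14613Admissible
import Literature.Barriers.BirchSwinnertonDyer.AnomalousHeegnerLogWall
import Literature.NumberTheory.EllipticCurves.Rank1Residual.GVParityTwistProofs
import Literature.NumberTheory.EllipticCurves.MazurTorsionGaloisStructureProofs
import Literature.NumberTheory.EllipticCurves.IwasawaLeadingTermProofs
import HarnessLib

/-!
# BirchSwinnertonDyer / ShaPrimaryTransfer — crux `FiniteShaComponentTransfer` (stmt-BirchSwinnertonDyer-22356):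
# the RANK-2 door `E_{146/13}^{(-4)}` at `5` is an anomalous Eisenstein pair too — and at corank `2` no `p`-converse exists at all

Helper file of prover seat `bsd-line-spt-p1` g21 (`--supports stmt-22356 --as helper`). THEOREMS ONLY, pure placement. The tree proves
unconditionally that `W = E_{146/13}^{(-4)}` has `rank W(ℚ) = 2`, `t₅(W) = 0` (`…GaussianTwistDoor14613`), `W(ℚ)_tors = 0`, `a₅(W) = −4`, `5`
good ordinary (`…GaussianTwistDoor14613Admissible`).  Placement of the door prime:

* `red_five`, `red_five_twist` — `E_{146/13}[5]` and `W[5]` are reducible (rational `5`-torsion point; quadratic twist);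
* `anom_five_twist` — **`Rank1Residual.Anom W 5`** (`a₅ = −4 ≡ 1 (mod 5)`), `not_printedScope_five_twist` — outside the printed scope of every
  refereed Eisenstein Heegner-log / `p`-converse theorem (barrier `AnomalousHeegnerLogWall`).
* Independently of the wall: `corank_{ℤ₅} Sel_{5^∞}(W) = 2`, and NO `p`-converse theorem (printed or announced) concludes `ord_{s=1} L = 2`
  from corank `2` — this row is the open core of T for the instrument; `transfer_twist_of_shaFinite` records that T at `W` is «`Ш(W/ℚ)`
  has all coranks `0`», which here is open mathematics (analytic rank `2` expected, `L''(W,1)` not linked to `Ш` by any theorem).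

T is UNCHANGED (conjecture-grade at corank ≥ 2) and BSD is NOT proved by any of this.

## References

* [SilvermanAEC2009] J. H. Silverman, *AEC*, 2nd ed., VII.3, X.5 Cor. 5.4.
* [Mazur1977] B. Mazur, *Modular curves and the Eisenstein ideal*, Ch. III §5.
* [CastellaGrossiLeeSkinner2022] F. Castella, G. Grossi, J. Lee, C. Skinner, Invent. Math. 227 (2022), Thm. E (hypothesis `φ|G_p ≠ 1, ω`).
* [KrizLi2019] D. Kriz, C. Li, Thm. 1.12 (first bullet).
-/

-- D-0017: single-problem summit, so `Summit.BirchSwinnertonDyer.BirchSwinnertonDyer.…` repeats a namespace BY DESIGN.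
set_option linter.dupNamespace false
set_option autoImplicit false

noncomputable section

open scoped Classical
open Literature.NumberTheory.EllipticCurves WeierstrassCurve
open Literature.NumberTheory.EllipticCurves.Rank1Residual
open Literature.Barriers.BirchSwinnertonDyer
open Summit.BirchSwinnertonDyer.BirchSwinnertonDyer.Theses.ShaPrimaryTransfer
open Summit.BirchSwinnertonDyer.BirchSwinnertonDyer.Theorems

namespace Summit.BirchSwinnertonDyer.BirchSwinnertonDyer.Theorems.ShaPrimaryTransferGaussianTwistDoor14613Anomalous

/-- **`E_{146/13}[5]` is reducible** (rational point of order `5`). [cite: Mazur1977, Ch. III §5, p. 157] -/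
theorem red_five :
    haveI : Fact (Nat.Prime 5) := ⟨Nat.prime_five⟩
    ¬ (kubertTateFive (((146 : ℤ) : ℚ)) (((13 : ℤ) : ℚ))).HasIrreducibleModPGaloisRep 5 := by
  haveI := KubertTate14613Descent.isElliptic
  haveI : Fact (Nat.Prime 5) := ⟨Nat.prime_five⟩
  obtain ⟨P, hP⟩ := exists_addOrderOf_eq_five_kubertTateFive (F := ℚ) (m := (((146 : ℤ) : ℚ))) (n := (((13 : ℤ) : ℚ)))
    (by norm_num) (by norm_num)
  exact not_hasIrreducibleModPGaloisRep_of_addOrderOf_eq _ hP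

/-- **`E_{146/13}^{(-4)}[5]` is reducible.** [cite: SilvermanAEC2009, X.5 Cor. 5.4] -/
theorem red_five_twist :
    haveI : Fact (Nat.Prime 5) := ⟨Nat.prime_five⟩
    ¬ ((kubertTateFive (((146 : ℤ) : ℚ)) (((13 : ℤ) : ℚ))).quadraticTwist (-4)).HasIrreducibleModPGaloisRep 5 := by
  haveI := KubertTate14613Descent.isElliptic
  haveI := ShaPrimaryTransferGaussianTwistDoor14613.isElliptic_twist
  haveI : Fact (Nat.Prime 5) := ⟨Nat.prime_five⟩
  exact not_hasIrreducibleModPGaloisRep_twist red_five (d := -4) (by norm_num) _ 1 (one_smul _ _)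

/-- **`(E_{146/13}^{(-4)}, 5)` is an anomalous Eisenstein pair**: reducible, good at `5`, `a₅ = −4 ≡ 1 (mod 5)`.
[cite: KrizLi2019, Thm. 1.12 (first bullet)] [cite: SilvermanAEC2009, VII.3.1(b)] -/
theorem anom_five_twist :
    haveI := ShaPrimaryTransferGaussianTwistDoor14613Admissible.isGloballyMinimal_twist
    haveI : Fact (Nat.Prime 5) := ⟨Nat.prime_five⟩
    Anom ((kubertTateFive (((146 : ℤ) : ℚ)) (((13 : ℤ) : ℚ))).quadraticTwist (-4)) 5 := by
  haveI := ShaPrimaryTransferGaussianTwistDoor14613Admissible.isGloballyMinimal_twist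
  haveI : Fact (Nat.Prime 5) := ⟨Nat.prime_five⟩
  refine ⟨red_five_twist, ShaPrimaryTransferGaussianTwistDoor14613Admissible.goodOrdinary_five_twist.1, ?_⟩
  rw [ShaPrimaryTransferGaussianTwistDoor14613Admissible.frobeniusTrace_five_twist]
  norm_num

/-- **The rank-2 door `(E_{146/13}^{(-4)}, 5)` is outside the printed scope of every refereed Eisenstein Heegner-log / `p`-converse theorem.**
[cite: CastellaGrossiLeeSkinner2022, Thm. E (hypothesis φ|G_p ≠ 1, ω)] [cite: KrizLi2019, Thm. 1.12 (first bullet)] -/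
theorem not_printedScope_five_twist :
    haveI := ShaPrimaryTransferGaussianTwistDoor14613Admissible.isGloballyMinimal_twist
    haveI : Fact (Nat.Prime 5) := ⟨Nat.prime_five⟩
    ¬ PrintedEisensteinHeegnerLogScope ((kubertTateFive (((146 : ℤ) : ℚ)) (((13 : ℤ) : ℚ))).quadraticTwist (-4)) 5 := by
  haveI := ShaPrimaryTransferGaussianTwistDoor14613Admissible.isGloballyMinimal_twist
  haveI : Fact (Nat.Prime 5) := ⟨Nat.prime_five⟩
  exact AnomalousHeegnerLogWall.not_printedScope_of_anom anom_five_twist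

/-- **What T says here**: with `t₅(W) = 0` proved, T at `W = E_{146/13}^{(-4)}` is implied by (and equivalent to) «every `Ш(W/ℚ)[q^∞]` has
corank `0`», e.g. by `Ш(W/ℚ)` finite — open at corank `2`. [cite: SilvermanAEC2009, Thm. X.4.2] -/
theorem transfer_twist_of_shaFinite
    (hfin : haveI := ShaPrimaryTransferGaussianTwistDoor14613.isElliptic_twist
      Finite ((kubertTateFive (((146 : ℤ) : ℚ)) (((13 : ℤ) : ℚ))).quadraticTwist (-4)).sha)
    (p q : ℕ) [Fact p.Prime] [Fact q.Prime] :
    haveI := ShaPrimaryTransferGaussianTwistDoor14613.isElliptic_twist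
    ((kubertTateFive (((146 : ℤ) : ℚ)) (((13 : ℤ) : ℚ))).quadraticTwist (-4)).shaCorank p = 0 →
      ((kubertTateFive (((146 : ℤ) : ℚ)) (((13 : ℤ) : ℚ))).quadraticTwist (-4)).shaCorank q = 0 := by
  haveI := ShaPrimaryTransferGaussianTwistDoor14613.isElliptic_twist
  intro _
  haveI := hfin
  exact (finite_primaryComponent_sha_iff_shaCorank_eq_zero _ q).1 inferInstance

end Summit.BirchSwinnertonDyer.BirchSwinnertonDyer.Theorems.ShaPrimaryTransferGaussianTwistDoor14613Anomalous

end
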